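import Mathlib
import HarnessLib
import Summits.HubbardSuperconductivity.HubbardSuperconductivity.Theorems.KLProgrammeKLRegimeCountertermJacksonRemainderCertFrameDefs
import Summits.HubbardSuperconductivity.HubbardSuperconductivity.Theorems.KLProgrammeKLRegimeCountertermJacksonRemainderCertAngle
import Summits.HubbardSuperconductivity.HubbardSuperconductivity.Theorems.KLProgrammeKLRegimeCountertermJacksonKernelTailSharp
import Summits.HubbardSuperconductivity.HubbardSuperconductivity.Theorems.KLProgrammeKLRegimeFlowShellJetsFlatCutoff
import Summits.HubbardSuperconductivity.HubbardSuperconductivity.Theorems.KLProgrammeKLRegimeSplitCompGradedBounds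
import Summits.HubbardSuperconductivity.HubbardSuperconductivity.Theorems.KLProgrammeKLRegimeSplitFrameFnLemmas
import Summits.HubbardSuperconductivity.HubbardSuperconductivity.Theorems.KLProgrammePerturbedFermiCurveCompChainStruct

/-!
# (C1) JACKSON REMAINDER AT DEEP SCALES — ANALYTIC majorants for the certificate's CUTOFF-DEFECT rows (`N0`, `N₁…N₄`), every degree `d`

Cell `gate-hubbard-kl`, seat hubbard-kl-k3c3-p3 (g11), `--supports stmt-HubbardSuperconductivity-20437` (stub (C) of `KLRegimeEngineV17F2`); pen (R79)
«(C1)-DEEP analytic supplier», part (β) of memo `HOME/hubbard-kl-k3c3-p3/C1-JETBOX-DEEP.md` §6(i): an ANALYTIC instance of k3c3-p1's certificate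
hypothesis `CutoffDefectCert(Frame) d … T` with a closed-form table `T_an(d)`, so that the consumer `flowPiece_reading_remainder_jets_of_cert(Frame)`
applies verbatim at every deep reading scale.  This file does the rows that involve the displaced CUTOFF only (no angular jets):

* §1 the free band is `2`-Lipschitz in the `ℓ¹` metric (`abs_freeBandFn_sub_le`); **NEAR-SQUARE VANISHING**: if the curve point is `A₀`-close to
  the level and `2(|s|+|t|) + A₀ ≤ klFlatR`, the displaced cutoff `certCutoff μ r w` is IDENTICALLY `1` (`certCutoff_eq_one_of_near`), so every
  cutoff-defect integrand vanishes on the near square (`iteratedDeriv_certCutoff_eq_zero_of_near`);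
* §2 GLOBAL graded sizes of the flat cutoff on `Momentum`: `‖Dⁱ(klFlatCutoffFn μ ∘ ofLp)‖ ≤ Xᵢ` with the closed numerals
  `X = Bell((160/3, 75200/9, 3.6·10⁸, 6.56·10¹¹); (4,4,4,4)) = (640/3, 1205120/9, 23040401280, 1512668168424320/9)`
  (`norm_iteratedFDeriv_klFlatCutoffFn_ofLp_le`; …FlowShellJetsFlatCutoff's profile numerals through …CompGradedBounds' graded chain rule, the
  band's derivatives `≤ 4`; loose by the known ×210/×700 of the in-tree `χ₂‴, χ₂⁗` bounds);
* §3 the displaced cutoff's jets at the base angle for EVERY displacement: `|∂ⁱ certCutoff μ r w (θ)| ≤ Bell_i(X; D)` with GRADED curve jets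
  `‖(certCurve r)^{(j)}(θ)‖ ≤ D j` (`abs_iteratedDeriv_certCutoff_le`; the displacement is constant in `ϑ`);
* §4 **the analytic `nq`-rows**: majorants `nq i w := c_i·(𝟙_{δ₀<|s|} + 𝟙_{δ₀<|t|})` (zero on the near square by §1, the §3 constants on the far
  region), integrable, with moments `≤ c_i·farMass♯(d, δ₀)`, `farMass♯ = (16/π)(24/23)⁴/((d+1)δ₀)³ + π³/(d+1)³` (…JacksonKernelTailSharp) — i.e.
  `T_an.N0 = farMass♯`, `T_an.N i = Bell_i(X; D)·farMass♯` (`certCutoffRows_analytic`).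

The `Mc`/`Tt`/`Tu`/`Td` rows (displaced polar-angle jets) are the next file of the lane.  Pure real analysis; no definitions; nothing about the
Hubbard model.
-/

noncomputable section

namespace Summit.HubbardSuperconductivity.HubbardSuperconductivity.Theorems.KLRegimeSplit

set_option linter.dupNamespace false -- summit = problem name (single-conjunct summit), D-0017

open Real MeasureTheory Set
open Literature.MathematicalPhysics.QuantumLattice
open Summit.HubbardSuperconductivity.HubbardSuperconductivity.Theorems.PerturbedFermiCurve

/-! ## §1 The near square: the displaced cutoff is identically one -/

/-- `|cos a − cos b| ≤ |a − b|`. -/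
private theorem abs_cos_sub_cos_le_aux (a b : ℝ) : |Real.cos a - Real.cos b| ≤ |a - b| := by
  rw [Real.cos_sub_cos]
  have h1 : |Real.sin ((a + b) / 2)| ≤ 1 := Real.abs_sin_le_one _
  have h2 : |Real.sin ((a - b) / 2)| ≤ |(a - b) / 2| := Real.abs_sin_le_abs
  calc |-2 * Real.sin ((a + b) / 2) * Real.sin ((a - b) / 2)|
      = 2 * (|Real.sin ((a + b) / 2)| * |Real.sin ((a - b) / 2)|) := by
        rw [abs_mul, abs_mul, abs_neg, abs_two]; ring
    _ ≤ 2 * (1 * |(a - b) / 2|) := by gcongr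
    _ = |a - b| := by rw [abs_div, abs_two]; ring

/-- **The free band is `2`-Lipschitz in the `ℓ¹` metric**: `|ε(p) − ε(q)| ≤ 2(|p₀ − q₀| + |p₁ − q₁|)`. -/
theorem abs_freeBandFn_sub_le (p q : Fin 2 → ℝ) : |freeBandFn p - freeBandFn q| ≤ 2 * (|p 0 - q 0| + |p 1 - q 1|) := by
  simp only [freeBandFn]
  have h0 := abs_cos_sub_cos_le_aux (p 0) (q 0)
  have h1 := abs_cos_sub_cos_le_aux (p 1) (q 1)
  calc |-2 * (Real.cos (p 0) + Real.cos (p 1)) - -2 * (Real.cos (q 0) + Real.cos (q 1))|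
      = 2 * |(Real.cos (p 0) - Real.cos (q 0)) + (Real.cos (p 1) - Real.cos (q 1))| := by
        rw [show -2 * (Real.cos (p 0) + Real.cos (p 1)) - -2 * (Real.cos (q 0) + Real.cos (q 1)) =
          (-2) * ((Real.cos (p 0) - Real.cos (q 0)) + (Real.cos (p 1) - Real.cos (q 1))) by ring, abs_mul]
        norm_num
    _ ≤ 2 * (|Real.cos (p 0) - Real.cos (q 0)| + |Real.cos (p 1) - Real.cos (q 1)|) := by gcongr; exact abs_add_le _ _
    _ ≤ 2 * (|p 0 - q 0| + |p 1 - q 1|) := by gcongr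

/-- The displaced curve point in coordinates. -/
theorem ofLp_certCurve_sub_jshift (r : ℝ → ℝ) (w : ℝ × ℝ) (ϑ : ℝ) :
    WithLp.ofLp (certCurve r ϑ - jshift w) = r ϑ • dir ϑ - ![w.1, w.2] := by
  simp [certCurve, jshift]

/-- **NEAR-SQUARE VANISHING.**  If the curve point `r(ϑ)·dir ϑ` is `A₀`-close to the level `μ` (`|ε − μ| ≤ A₀`) and the displacement is small in
`ℓ¹`, `2(|s| + |t|) + A₀ ≤ klFlatR`, then the displaced flat cutoff is `1` at `ϑ`. -/
theorem certCutoff_eq_one_of_near {μ A₀ : ℝ} {r : ℝ → ℝ} {ϑ : ℝ} (hlev : |freeBandFn (r ϑ • dir ϑ) - μ| ≤ A₀) {w : ℝ × ℝ}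
    (hw : 2 * (|w.1| + |w.2|) + A₀ ≤ klFlatR) : certCutoff μ r w ϑ = 1 := by
  rw [certCutoff_apply, ofLp_certCurve_sub_jshift]
  apply klFlatCutoffFn_eq_one_of_abs_le
  have hlip := abs_freeBandFn_sub_le (r ϑ • dir ϑ - ![w.1, w.2]) (r ϑ • dir ϑ)
  have e0 : (r ϑ • dir ϑ - ![w.1, w.2]) 0 - (r ϑ • dir ϑ) 0 = -w.1 := by simp
  have e1 : (r ϑ • dir ϑ - ![w.1, w.2]) 1 - (r ϑ • dir ϑ) 1 = -w.2 := by simp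
  rw [e0, e1, abs_neg, abs_neg] at hlip
  calc |freeBandFn (r ϑ • dir ϑ - ![w.1, w.2]) - μ|
      = |(freeBandFn (r ϑ • dir ϑ - ![w.1, w.2]) - freeBandFn (r ϑ • dir ϑ)) + (freeBandFn (r ϑ • dir ϑ) - μ)| := by ring_nf
    _ ≤ |freeBandFn (r ϑ • dir ϑ - ![w.1, w.2]) - freeBandFn (r ϑ • dir ϑ)| + |freeBandFn (r ϑ • dir ϑ) - μ| := abs_add_le _ _
    _ ≤ 2 * (|w.1| + |w.2|) + A₀ := add_le_add hlip hlev
    _ ≤ klFlatR := hw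

/-- **On the near square the displaced cutoff is the constant function `1`** (the level hypothesis at every angle). -/
theorem certCutoff_eq_const_one_of_near {μ A₀ : ℝ} {r : ℝ → ℝ} (hlev : ∀ ϑ, |freeBandFn (r ϑ • dir ϑ) - μ| ≤ A₀) {w : ℝ × ℝ}
    (hw : 2 * (|w.1| + |w.2|) + A₀ ≤ klFlatR) : certCutoff μ r w = fun _ => 1 :=
  funext fun ϑ => certCutoff_eq_one_of_near (hlev ϑ) hw

/-- **Hence every cutoff-defect integrand vanishes on the near square**: `|χ_w(θ) − 1| = 0` and `∂ⁱχ_w(θ) = 0` for `i ≥ 1`. -/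
theorem iteratedDeriv_certCutoff_eq_zero_of_near {μ A₀ : ℝ} {r : ℝ → ℝ} (hlev : ∀ ϑ, |freeBandFn (r ϑ • dir ϑ) - μ| ≤ A₀) {w : ℝ × ℝ}
    (hw : 2 * (|w.1| + |w.2|) + A₀ ≤ klFlatR) {i : ℕ} (hi : 1 ≤ i) (θ : ℝ) : iteratedDeriv i (certCutoff μ r w) θ = 0 := by
  rw [certCutoff_eq_const_one_of_near hlev hw, iteratedDeriv_const, if_neg (by omega)]

/-- On the near square `|χ_w(θ) − 1| = 0`. -/
theorem abs_certCutoff_sub_one_eq_zero_of_near {μ A₀ : ℝ} {r : ℝ → ℝ} (hlev : ∀ ϑ, |freeBandFn (r ϑ • dir ϑ) - μ| ≤ A₀) {w : ℝ × ℝ}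
    (hw : 2 * (|w.1| + |w.2|) + A₀ ≤ klFlatR) (θ : ℝ) : |certCutoff μ r w θ - 1| = 0 := by
  rw [certCutoff_eq_one_of_near (hlev θ) hw, sub_self, abs_zero]

/-! ## §2 Global graded sizes of the flat cutoff on `Momentum` -/

/-! The flat cutoff's momentum-space numerals `X₁…X₄ = (640/3, 1205120/9, 23040401280, 1512668168424320/9)`
(`≈ 213.4, 1.339·10⁵, 2.304·10¹⁰, 1.681·10¹⁴`): the Bell polynomials of the profile numerals `(160/3, 75200/9, 3.6·10⁸, 6.56·10¹¹)`
(…FlowShellJetsFlatCutoff) against the band's `‖Dʲε‖ ≤ 4` — written as literals (no definition). -/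

/-- **GLOBAL graded sizes of the flat cutoff read on `Momentum`**: `‖Dⁱ(q ↦ klFlatCutoffFn μ (ofLp q))(q)‖ ≤ Xᵢ`, `1 ≤ i ≤ 4`, every `q`. -/
theorem norm_iteratedFDeriv_klFlatCutoffFn_ofLp_le (μ : ℝ) {i : ℕ} (hi1 : 1 ≤ i) (hi4 : i ≤ 4) (q : EuclideanSpace ℝ (Fin 2)) :
    ‖iteratedFDeriv ℝ i (fun q : EuclideanSpace ℝ (Fin 2) => klFlatCutoffFn μ (WithLp.ofLp q)) q‖ ≤
      (fun i : ℕ => if i = 1 then (640 / 3 : ℝ) else if i = 2 then 1205120 / 9 else if i = 3 then 23040401280 else 1512668168424320 / 9) i := by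
  -- the function is `ψ ∘ (ε − μ)`
  have hfun : (fun q : EuclideanSpace ℝ (Fin 2) => klFlatCutoffFn μ (WithLp.ofLp q)) =
      fun q => (fun ξ : ℝ => 1 - salmhoferCutoff (ξ ^ 2 / (4 * klFlatR ^ 2))) (sqDispersion (WithLp.ofLp q) - μ) := by
    funext q; rw [klFlatCutoffFn_ofLp_eq, squareDispersion_one_zero_eq_sqDispersion]
  rw [hfun]
  have hψ : ContDiff ℝ 4 (fun ξ : ℝ => 1 - salmhoferCutoff (ξ ^ 2 / (4 * klFlatR ^ 2))) :=
    PerturbedFermiCurve.contDiff_flatProfile (n := 4)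
  have hθ : ContDiffOn ℝ 4 (fun q : EuclideanSpace ℝ (Fin 2) => sqDispersion (WithLp.ofLp q) - μ) univ :=
    (contDiff_sqDispersion_ofLp.sub contDiff_const).contDiffOn
  -- profile jets
  have hb : ∀ k, 1 ≤ k → k ≤ 4 → ∀ t : ℝ, ‖iteratedFDeriv ℝ k (fun ξ : ℝ => 1 - salmhoferCutoff (ξ ^ 2 / (4 * klFlatR ^ 2))) t‖ ≤
      (fun k : ℕ => if k = 1 then (160 / 3 : ℝ) else if k = 2 then 75200 / 9 else if k = 3 then 360000000 else 656000000000) k := by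
    intro k hk1 hk4 t
    obtain ⟨a1, a2, a3, a4⟩ := flatProfile_jets_le t
    interval_cases k
    · simpa using a1
    · simpa using a2
    · simpa using a3
    · simpa using a4
  -- band jets (the constant shift does not change positive-order derivatives)
  have hX : ∀ j, 1 ≤ j → j ≤ 4 → ‖iteratedFDeriv ℝ j (fun q : EuclideanSpace ℝ (Fin 2) => sqDispersion (WithLp.ofLp q) - μ) q‖ ≤
      (fun _ : ℕ => (4 : ℝ)) j := by
    intro j hj1 _
    have e : (fun q : EuclideanSpace ℝ (Fin 2) => sqDispersion (WithLp.ofLp q) - μ) =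
        (fun q : EuclideanSpace ℝ (Fin 2) => sqDispersion (WithLp.ofLp q)) + fun _ => (-μ) := by funext q; simp; ring
    have hs : ContDiff ℝ j (fun q : EuclideanSpace ℝ (Fin 2) => sqDispersion (WithLp.ofLp q)) := contDiff_sqDispersion_ofLp
    rw [e, iteratedFDeriv_add_apply hs.contDiffAt contDiff_const.contDiffAt, iteratedFDeriv_const_of_ne (by omega), Pi.zero_apply, add_zero]
    exact norm_iteratedFDeriv_sqDispersion_ofLp_le j q
  obtain ⟨h1, h2, h3, h4⟩ := norm_iteratedFDeriv_comp_le_graded isOpen_univ (mem_univ q) hψ hθ hb hX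
  simp only [show (2 : ℕ) ≠ 1 by norm_num, show (3 : ℕ) ≠ 1 by norm_num, show (3 : ℕ) ≠ 2 by norm_num, show (4 : ℕ) ≠ 1 by norm_num,
    show (4 : ℕ) ≠ 2 by norm_num, show (4 : ℕ) ≠ 3 by norm_num, ↓reduceIte] at h1 h2 h3 h4
  interval_cases i
  · refine h1.trans (le_of_eq ?_); norm_num
  · refine h2.trans (le_of_eq ?_); norm_num
  · refine h3.trans (le_of_eq ?_); norm_num
  · refine h4.trans (le_of_eq ?_); norm_num

/-! ## §3 The displaced cutoff's jets at the base angle, every displacement -/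

/-- The displaced curve's positive-order jets are the curve's. -/
theorem iteratedDeriv_certCurve_sub_jshift {r : ℝ → ℝ} (w : ℝ × ℝ) {j : ℕ} (hj : 1 ≤ j) (θ : ℝ) :
    iteratedDeriv j (fun ϑ => certCurve r ϑ - jshift w) θ = iteratedDeriv j (certCurve r) θ := by
  have e : (fun ϑ => certCurve r ϑ - jshift w) = fun ϑ => (-jshift w) + certCurve r ϑ := by funext ϑ; abel
  rw [e, iteratedDeriv_const_add (by omega)]

/-- **The displaced cutoff's jets at the base angle, for EVERY displacement `w`**: with graded curve jets `‖(certCurve r)^{(j)}(θ)‖ ≤ D j`,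
`|∂¹χ_w(θ)| ≤ X₁D₁`, `|∂²| ≤ X₂D₁² + X₁D₂`, `|∂³| ≤ X₃D₁³ + 3X₂D₁D₂ + X₁D₃`, `|∂⁴| ≤ X₄D₁⁴ + 6X₃D₁²D₂ + 3X₂D₂² + 4X₂D₁D₃ + X₁D₄`,
`(X₁, X₂, X₃, X₄) = (640/3, 1205120/9, 23040401280, 1512668168424320/9)`. -/
theorem abs_iteratedDeriv_certCutoff_le (μ : ℝ) {r : ℝ → ℝ} (hr : ContDiff ℝ 4 r) (w : ℝ × ℝ) {θ : ℝ} {D : ℕ → ℝ}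
    (hD : ∀ j, 1 ≤ j → j ≤ 4 → ‖iteratedDeriv j (certCurve r) θ‖ ≤ D j) :
    |iteratedDeriv 1 (certCutoff μ r w) θ| ≤ 640 / 3 * D 1 ∧
    |iteratedDeriv 2 (certCutoff μ r w) θ| ≤ 1205120 / 9 * D 1 ^ 2 + 640 / 3 * D 2 ∧
    |iteratedDeriv 3 (certCutoff μ r w) θ| ≤ 23040401280 * D 1 ^ 3 + 3 * (1205120 / 9) * D 1 * D 2 + 640 / 3 * D 3 ∧
    |iteratedDeriv 4 (certCutoff μ r w) θ| ≤
      1512668168424320 / 9 * D 1 ^ 4 + 6 * 23040401280 * D 1 ^ 2 * D 2 + 3 * (1205120 / 9) * D 2 ^ 2 +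
        4 * (1205120 / 9) * D 1 * D 3 + 640 / 3 * D 4 := by
  set F : EuclideanSpace ℝ (Fin 2) → ℝ := fun q => klFlatCutoffFn μ (WithLp.ofLp q) with hFdef
  set γ : ℝ → EuclideanSpace ℝ (Fin 2) := fun ϑ => certCurve r ϑ - jshift w with hγdef
  have hfun : certCutoff μ r w = F ∘ γ := by funext ϑ; rfl
  have hF : ContDiff ℝ 4 F := contDiff_klFlatCutoffFn_ofLp μ
  have hγ : ContDiff ℝ 4 γ := (contDiff_certCurve hr).sub contDiff_const
  have hM : ∀ k, 1 ≤ k → k ≤ 4 → ‖iteratedFDeriv ℝ k F (γ θ)‖ ≤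
      (fun i : ℕ => if i = 1 then (640 / 3 : ℝ) else if i = 2 then 1205120 / 9 else if i = 3 then 23040401280 else 1512668168424320 / 9) k :=
    fun k hk1 hk4 => norm_iteratedFDeriv_klFlatCutoffFn_ofLp_le μ hk1 hk4 _
  have hD' : ∀ i, 1 ≤ i → i ≤ 4 → ‖iteratedDeriv i γ θ‖ ≤ D i := by
    intro i hi1 hi4; rw [hγdef, iteratedDeriv_certCurve_sub_jshift w hi1]; exact hD i hi1 hi4
  rw [hfun]
  have h := abs_iteratedDeriv_comp_le_bell hF hγ hM hD'
  simp only [show (2 : ℕ) ≠ 1 by norm_num, show (3 : ℕ) ≠ 1 by norm_num, show (3 : ℕ) ≠ 2 by norm_num, show (4 : ℕ) ≠ 1 by norm_num,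
    show (4 : ℕ) ≠ 2 by norm_num, show (4 : ℕ) ≠ 3 by norm_num, ↓reduceIte] at h
  exact h

/-! ## §4 The analytic `nq`-rows: zero near, constants far, moments by the sharp far mass -/

/-- The far indicator sum `𝟙_{δ₀<|s|} + 𝟙_{δ₀<|t|}` dominates `1` off the near square `|s|, |t| ≤ δ₀`. -/
theorem one_le_jfar_add_of_not_near {δ₀ : ℝ} {w : ℝ × ℝ} (hw : ¬(|w.1| ≤ δ₀ ∧ |w.2| ≤ δ₀)) :
    (1 : ℝ) ≤ Set.indicator {s : ℝ | δ₀ < |s|} (1 : ℝ → ℝ) w.1 + Set.indicator {s : ℝ | δ₀ < |s|} (1 : ℝ → ℝ) w.2 := by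
  rcases not_and_or.mp hw with h | h
  · rw [jfar_eq_one (not_le.mp h)]; linarith [jfar_nonneg δ₀ w.2]
  · rw [jfar_eq_one (not_le.mp h)]; linarith [jfar_nonneg δ₀ w.1]

/-- **THE ANALYTIC CUTOFF-DEFECT ROWS.**  Let the curve point be `A₀`-close to the level at every angle (`|ε(r(ϑ)dir ϑ) − μ| ≤ A₀`), `r ∈ C⁴`
with graded jets `‖(certCurve r)^{(j)}(θ)‖ ≤ D j` (`D j ≥ 0`), and `0 < δ₀ ≤ 1` with `4δ₀ + A₀ ≤ klFlatR` (near square inside the flat tube).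
Then the majorants `nq i w := c i·(𝟙_{δ₀<|s|} + 𝟙_{δ₀<|t|})` with `c 0 = 1`, `c i = Bell_i(X; D)` (`1 ≤ i ≤ 4`) are integrable against
`J̃_dJ̃_d`, dominate `|χ_w(θ) − 1|` and `|∂ⁱχ_w(θ)|` for EVERY displacement, and have moments `≤ c i·((16/π)(24/23)⁴/((d+1)δ₀)³ + π³/(d+1)³)` —
the `N0`/`N` rows of an analytic certificate table, for every Jackson degree `d` (`X` = the §2 numerals). -/
theorem certCutoffRows_analytic (d : ℕ) {μ A₀ δ₀ : ℝ} {r : ℝ → ℝ} (hr : ContDiff ℝ 4 r)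
    (hlev : ∀ ϑ, |freeBandFn (r ϑ • dir ϑ) - μ| ≤ A₀) {θ : ℝ} {D : ℕ → ℝ} (hD0 : ∀ j, 0 ≤ D j)
    (hD : ∀ j, 1 ≤ j → j ≤ 4 → ‖iteratedDeriv j (certCurve r) θ‖ ≤ D j) (hδ₀ : 0 < δ₀) (hδ₁ : δ₀ ≤ 1) (hnear : 4 * δ₀ + A₀ ≤ klFlatR) :
    let c : ℕ → ℝ := fun i =>
      if i = 0 then 1 else if i = 1 then 640 / 3 * D 1 else if i = 2 then 1205120 / 9 * D 1 ^ 2 + 640 / 3 * D 2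
      else if i = 3 then 23040401280 * D 1 ^ 3 + 3 * (1205120 / 9) * D 1 * D 2 + 640 / 3 * D 3
      else 1512668168424320 / 9 * D 1 ^ 4 + 6 * 23040401280 * D 1 ^ 2 * D 2 + 3 * (1205120 / 9) * D 2 ^ 2 +
        4 * (1205120 / 9) * D 1 * D 3 + 640 / 3 * D 4
    let nq : ℕ → ℝ × ℝ → ℝ := fun i w =>
      c i * (Set.indicator {s : ℝ | δ₀ < |s|} (1 : ℝ → ℝ) w.1 + Set.indicator {s : ℝ | δ₀ < |s|} (1 : ℝ → ℝ) w.2)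
    (∀ i, Integrable (fun w => jweight d w * nq i w) jmeas) ∧
    (∀ w : ℝ × ℝ, |certCutoff μ r w θ - 1| ≤ nq 0 w ∧ ∀ i, 1 ≤ i → i ≤ 4 → |iteratedDeriv i (certCutoff μ r w) θ| ≤ nq i w) ∧
    (∀ i, ∫ w, jweight d w * nq i w ∂jmeas ≤ c i * (16 / π * (24 / 23) ^ 4 / ((d + 1) * δ₀) ^ 3 + π ^ 3 / (d + 1) ^ 3)) := by
  intro c nq
  have hc0 : ∀ i, 0 ≤ c i := by
    intro i
    have d1 := hD0 1; have d2 := hD0 2; have d3 := hD0 3; have d4 := hD0 4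
    simp only [c]; split_ifs <;> positivity
  -- integrability: constant multiples of the two far-indicator integrands
  have hint : ∀ i, Integrable (fun w => jweight d w * nq i w) jmeas := by
    intro i
    have h := ((integrable_jweight_mul_jfar_fst d δ₀).add (integrable_jweight_mul_jfar_snd d δ₀)).const_mul (c i)
    refine h.congr (ae_of_all _ fun w => ?_)
    simp only [nq, Pi.add_apply]; ring
  refine ⟨hint, fun w => ?_, fun i => ?_⟩
  · -- pointwise domination: near square ⇒ zero; far ⇒ the constants
    by_cases hw : |w.1| ≤ δ₀ ∧ |w.2| ≤ δ₀
    · have hw' : 2 * (|w.1| + |w.2|) + A₀ ≤ klFlatR := by linarith [hw.1, hw.2]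
      refine ⟨?_, fun i hi1 _ => ?_⟩
      · rw [abs_certCutoff_sub_one_eq_zero_of_near hlev hw' θ]
        exact mul_nonneg (hc0 0) (add_nonneg (jfar_nonneg _ _) (jfar_nonneg _ _))
      · rw [iteratedDeriv_certCutoff_eq_zero_of_near hlev hw' hi1 θ, abs_zero]
        exact mul_nonneg (hc0 i) (add_nonneg (jfar_nonneg _ _) (jfar_nonneg _ _))
    · have hfar := one_le_jfar_add_of_not_near hw
      obtain ⟨b1, b2, b3, b4⟩ := abs_iteratedDeriv_certCutoff_le μ hr w hD
      refine ⟨?_, fun i hi1 hi4 => ?_⟩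
      · -- `|χ − 1| ≤ 1` (χ ∈ [0,1])
        have hχ : |certCutoff μ r w θ - 1| ≤ 1 := by
          rw [certCutoff_apply]
          unfold klFlatCutoffFn
          have h01 := salmhoferCutoff_mem_Icc ((freeBandFn (WithLp.ofLp (certCurve r θ - jshift w)) - μ) ^ 2 / (4 * klFlatR ^ 2))
          rw [abs_le]; constructor <;> linarith [h01.1, h01.2]
        calc |certCutoff μ r w θ - 1| ≤ 1 * 1 := by linarith
          _ ≤ c 0 * (Set.indicator {s : ℝ | δ₀ < |s|} (1 : ℝ → ℝ) w.1 + Set.indicator {s : ℝ | δ₀ < |s|} (1 : ℝ → ℝ) w.2) := by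
              have : c 0 = 1 := by simp [c]
              rw [this]; exact mul_le_mul_of_nonneg_left hfar zero_le_one
      · have hci : |iteratedDeriv i (certCutoff μ r w) θ| ≤ c i := by
          interval_cases i
          · simpa [c] using b1
          · simpa [c] using b2
          · simpa [c] using b3
          · simpa [c] using b4
        calc |iteratedDeriv i (certCutoff μ r w) θ| ≤ c i * 1 := by linarith
          _ ≤ c i * (Set.indicator {s : ℝ | δ₀ < |s|} (1 : ℝ → ℝ) w.1 + Set.indicator {s : ℝ | δ₀ < |s|} (1 : ℝ → ℝ) w.2) :=
              mul_le_mul_of_nonneg_left hfar (hc0 i)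
  · -- moments: constant × sharp far mass
    have hmass := integral_jweight_mul_jfar_le_sharp d hδ₀ hδ₁
    have e : (fun w : ℝ × ℝ => jweight d w * nq i w) = fun w =>
        c i * (jweight d w * (Set.indicator {s : ℝ | δ₀ < |s|} (1 : ℝ → ℝ) w.1 + Set.indicator {s : ℝ | δ₀ < |s|} (1 : ℝ → ℝ) w.2)) := by
      funext w; simp only [nq]; ring
    rw [e, integral_const_mul]
    exact mul_le_mul_of_nonneg_left hmass (hc0 i)

end Summit.HubbardSuperconductivity.HubbardSuperconductivity.Theorems.KLRegimeSplit

end
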